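import Summits.Parity.BatemanHorn.Theses.SelmerPencil
import Literature.NumberTheory.LFunctions.LiouvilleSumClassicalBound

/-!
# Strategy census for crux `LiouvilleRootClassLevel` (stmt-Parity-9648) — typed companion

Crux-strategist `planner-cstrat-stmt-Parity-9648-r1-0` (route `SelmerPencil`, RESTATED re-audit), 2026-08-17.
Companion to `STRATEGY-CENSUS.md` in this directory.  The decompositions / strengthenings of the crux
`L := LiouvilleRootClassLevel` that can be typed over the route's declarations are typed here, and every
glue that the census calls "trivial" or "bookkeeping" is PROVED (no `sorry`), so that the verdict
`no-decomposition` rests on kernel-checked implications and failing cheap probes (`bc/probes.lean`), not on prose.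

* §0 reading: `liouvilleRootClassLevel_iff` — the crux in terms of the ℓ¹ root-class functional `l1Range`.
* §D0 `η`-seam: `level_iff_smallEta` — the small-`η` piece is EQUIVALENT to the crux (anti-monotonicity in the level).
* §D1 range seam: `LevelHalfPiece` (moduli `m ≤ x^{1/2}`) ∧ `LevelBeyondHalfPiece` (`x^{1/2} < m ≤ x^{1-η}`)
  `→ L` — `level_of_rangeSplit`, an additive cut recombined by one inequality (TRIVIAL-SEAM by the exempt-46 standard).
* §D2 class seam: `LevelLinearPiece` (all `deg fᵢ ≤ 1`) ∧ `LevelNonlinearPiece` `→ L` — `level_of_classSplit`, `by_cases`.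
* §D6 max seam: `LevelNoMaxPiece` (cut-off `y = x`) is implied by `L` (`noMax_of_level`); the converse is not bookkeeping.
* §S  strengthening `UniformCofactorChowla` (termwise, ℓ^∞-normalised Chowla for the cofactor pencils, uniform in
  the root class) with the theorem-grade `RootCountMeanValue`; the reduction `U → T → L` is recorded as the Prop
  `UniformCofactorReduction` (sketch in its docstring).
* The Selmer-currency decomposition (`PencilSelmerParity ∧ SelmerParityLevel → L`) is the route's own support
  `ParityToLiouville` (item stmt-Parity-11298, refuter-proved as evidence); not restated here.
-/

namespace Summit.Parity.BatemanHorn.Cruxes.LiouvilleRootClassLevel.StrategyCensus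

open scoped BigOperators
open Filter Asymptotics Polynomial ArithmeticFunction
open Literature.NumberTheory.Sieve
open Summit.Parity.BatemanHorn.Theses.SelmerPencil

section Defs
variable {k : ℕ}

/-- The inner root-class sum of the crux: `Σ_{1 ≤ t ≤ y, t ≡ ρ (m), F(t) > 0} λ(F(t))`, `F = ∏ fᵢ`. -/
noncomputable def innerSum (f : Fin k → ℤ[X]) (m ρ y : ℕ) : ℝ :=
  ∑ t ∈ (Finset.Icc 1 y).filter (fun t : ℕ => t ≡ ρ [MOD m] ∧ 0 < (∏ i, f i).eval (t : ℤ)),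
    (liouville (((∏ i, f i).eval (t : ℤ)).toNat) : ℝ)

/-- The root classes of modulus `m`: `{ρ < m : m ∣ F(ρ)}`. -/
noncomputable def rootClasses (f : Fin k → ℤ[X]) (m : ℕ) : Finset ℕ :=
  (Finset.range m).filter (fun ρ : ℕ => (m : ℤ) ∣ (∏ i, f i).eval (ρ : ℤ))

/-- The ℓ¹ root-class functional over moduli `a ≤ m ≤ b` with cut-offs `y m ρ`. -/
noncomputable def l1Range (f : Fin k → ℤ[X]) (a b : ℕ) (y : ℕ → ℕ → ℕ) : ℝ :=
  ∑ m ∈ Finset.Icc a b, ∑ ρ ∈ rootClasses f m, |innerSum f m ρ (y m ρ)|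

/-- The conclusion of the crux for ONE system at level exponent `θ`: for every `A > 0`, eventually in `x`,
uniformly in cut-offs `y ≤ x`, `Σ_{m ≤ x^θ} Σ_ρ |innerSum| ≤ x / (log x)^A`. -/
def LevelAt (f : Fin k → ℤ[X]) (θ : ℝ) : Prop :=
  ∀ A : ℝ, 0 < A → ∃ x₀ : ℕ, ∀ x : ℕ, x₀ ≤ x → ∀ y : ℕ → ℕ → ℕ, (∀ m ρ, y m ρ ≤ x) →
    l1Range f 1 ⌊(x : ℝ) ^ θ⌋₊ y ≤ (x : ℝ) / Real.log x ^ A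

end Defs

/-! ## §0 Reading check -/

/-- The crux, verbatim, in terms of `LevelAt` (definitional). -/
theorem liouvilleRootClassLevel_iff :
    LiouvilleRootClassLevel ↔ ∀ (k : ℕ) (f : Fin k → ℤ[X]), 0 < k → IsBatemanHornSystem f →
      ∀ η : ℝ, 0 < η → η < 1 → LevelAt f (1 - η) :=
  Iff.rfl

section Lemmas
variable {k : ℕ}

theorem l1Range_nonneg (f : Fin k → ℤ[X]) (a b : ℕ) (y : ℕ → ℕ → ℕ) : 0 ≤ l1Range f a b y :=
  Finset.sum_nonneg fun _ _ => Finset.sum_nonneg fun _ _ => abs_nonneg _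

theorem l1Range_mono_right (f : Fin k → ℤ[X]) {b b' : ℕ} (h : b ≤ b') (y : ℕ → ℕ → ℕ) :
    l1Range f 1 b y ≤ l1Range f 1 b' y := by
  apply Finset.sum_le_sum_of_subset_of_nonneg (Finset.Icc_subset_Icc le_rfl h)
  intro m _ _
  exact Finset.sum_nonneg fun _ _ => abs_nonneg _

theorem Icc_split {a b : ℕ} (h : a ≤ b) :
    Finset.Icc 1 b = Finset.Icc 1 a ∪ Finset.Icc (a + 1) b := by
  ext m
  simp only [Finset.mem_Icc, Finset.mem_union]
  omega

theorem Icc_split_disjoint (a b : ℕ) : Disjoint (Finset.Icc 1 a) (Finset.Icc (a + 1) b) := by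
  rw [Finset.disjoint_left]
  intro m hm hm'
  simp only [Finset.mem_Icc] at hm hm'
  omega

/-- The additive range cut: `Σ_{m ≤ b} = Σ_{m ≤ a} + Σ_{a < m ≤ b}`. -/
theorem l1Range_split (f : Fin k → ℤ[X]) {a b : ℕ} (h : a ≤ b) (y : ℕ → ℕ → ℕ) :
    l1Range f 1 b y = l1Range f 1 a y + l1Range f (a + 1) b y := by
  unfold l1Range
  rw [Icc_split h, Finset.sum_union (Icc_split_disjoint a b)]

/-- `2·x/(log x)^{A+1} ≤ x/(log x)^A` once `log x ≥ 2`. -/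
theorem two_terms_le {x A : ℝ} (hx : 0 ≤ x) (hlog : 2 ≤ Real.log x) :
    x / Real.log x ^ (A + 1) + x / Real.log x ^ (A + 1) ≤ x / Real.log x ^ A := by
  have hlogpos : 0 < Real.log x := by linarith
  have hpow : Real.log x ^ (A + 1) = Real.log x ^ A * Real.log x := by
    rw [Real.rpow_add hlogpos, Real.rpow_one]
  have hB : 0 ≤ x / Real.log x ^ A := div_nonneg hx (Real.rpow_nonneg hlogpos.le _)
  rw [hpow, ← div_div, ← two_mul, mul_div_assoc', div_le_iff₀ hlogpos]
  nlinarith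

end Lemmas


/-! ## §D0 The `η`-seam: the small-`η` piece IS the crux -/

section Eta
variable {k : ℕ}

/-- Anti-monotonicity in the level exponent: a higher level bounds a lower one (sub-sum of non-negative terms). -/
theorem levelAt_anti (f : Fin k → ℤ[X]) {θ θ' : ℝ} (h : θ' ≤ θ) (hL : LevelAt f θ) : LevelAt f θ' := by
  intro A hA
  obtain ⟨x₀, hx₀⟩ := hL A hA
  refine ⟨max x₀ 1, fun x hx y hy => ?_⟩
  have hx0 : x₀ ≤ x := le_trans (le_max_left _ _) hx
  have hone : (1 : ℝ) ≤ x := by exact_mod_cast le_trans (le_max_right _ _) hx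
  have hle : ⌊(x : ℝ) ^ θ'⌋₊ ≤ ⌊(x : ℝ) ^ θ⌋₊ :=
    Nat.floor_le_floor (Real.rpow_le_rpow_of_exponent_le hone h)
  exact le_trans (l1Range_mono_right f hle y) (hx₀ x hx0 y hy)

end Eta

/-- D0 — the crux with `η` restricted to `(0, 1/2]` (levels `x^{1-η} ≥ x^{1/2}`, the "EH half" of the `η`-range). -/
def LevelSmallEtaPiece : Prop :=
  ∀ (k : ℕ) (f : Fin k → ℤ[X]), 0 < k → IsBatemanHornSystem f →
    ∀ η : ℝ, 0 < η → η ≤ 1 / 2 → LevelAt f (1 - η)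

/-- **D0 (proved both ways; PIECE-EQUIVALENT, class E1):** cutting the `η`-range is not a decomposition — the
small-`η` piece is literally equivalent to the crux, because `LevelAt f θ` is anti-monotone in `θ`. -/
theorem level_iff_smallEta : LiouvilleRootClassLevel ↔ LevelSmallEtaPiece := by
  constructor
  · intro h k f hk hf η hη0 hη1
    exact h k f hk hf η hη0 (by linarith)
  · intro h k f hk hf η hη0 hη1
    by_cases hη : η ≤ 1 / 2
    · exact h k f hk hf η hη0 hη
    · push Not at hη
      have half : LevelAt f (1 - 1 / 2) := h k f hk hf (1 / 2) (by norm_num) le_rfl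
      exact levelAt_anti f (by linarith) half

/-! ## §D1 The range seam (BV-range ∧ EH-range) -/

/-- D1a — the piece of the crux with moduli `m ≤ x^{1/2}` ("large-sieve range"; no `η`). -/
def LevelHalfPiece : Prop :=
  ∀ (k : ℕ) (f : Fin k → ℤ[X]), 0 < k → IsBatemanHornSystem f → LevelAt f (1 / 2)

/-- D1b — the piece with moduli `x^{1/2} < m ≤ x^{1-η}` ("Elliott–Halberstam range"). -/
def LevelBeyondHalfPiece : Prop :=
  ∀ (k : ℕ) (f : Fin k → ℤ[X]), 0 < k → IsBatemanHornSystem f →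
    ∀ η : ℝ, 0 < η → η < 1 → ∀ A : ℝ, 0 < A → ∃ x₀ : ℕ, ∀ x : ℕ, x₀ ≤ x → ∀ y : ℕ → ℕ → ℕ,
      (∀ m ρ, y m ρ ≤ x) →
        l1Range f (⌊(x : ℝ) ^ (1 / 2 : ℝ)⌋₊ + 1) ⌊(x : ℝ) ^ (1 - η)⌋₊ y ≤ (x : ℝ) / Real.log x ^ A

/-- **D1 glue (proved; TRIVIAL-SEAM):** the two range pieces give the crux by splitting the `m`-sum at
`⌊x^{1/2}⌋` and absorbing the factor `2` into one power of `log x`.  No estimate, identity or construction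
combines the pieces — this is the crux cut along an additive seam. -/
theorem level_of_rangeSplit (h₁ : LevelHalfPiece) (h₂ : LevelBeyondHalfPiece) :
    LiouvilleRootClassLevel := by
  intro k f hk hf η hη0 hη1 A hA
  obtain ⟨x₁, hx₁⟩ := h₁ k f hk hf (A + 1) (by linarith)
  obtain ⟨x₂, hx₂⟩ := h₂ k f hk hf η hη0 hη1 (A + 1) (by linarith)
  refine ⟨max (max x₁ x₂) ⌈Real.exp 2⌉₊, fun x hx y hy => ?_⟩
  have hx1 : x₁ ≤ x := le_trans (le_trans (le_max_left _ _) (le_max_left _ _)) hx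
  have hx2 : x₂ ≤ x := le_trans (le_trans (le_max_right _ _) (le_max_left _ _)) hx
  have hxc : ⌈Real.exp 2⌉₊ ≤ x := le_trans (le_max_right _ _) hx
  have hxe : Real.exp 2 ≤ (x : ℝ) := le_trans (Nat.le_ceil _) (by exact_mod_cast hxc)
  have hxpos : (0 : ℝ) < x := lt_of_lt_of_le (Real.exp_pos 2) hxe
  have hlog : 2 ≤ Real.log x := (Real.le_log_iff_exp_le hxpos).2 hxe
  have hone : (1 : ℝ) ≤ x := by
    have h1 : (1 : ℝ) ≤ Real.exp 2 := by
      have := Real.add_one_le_exp (2 : ℝ)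
      linarith
    linarith
  have H₁ := hx₁ x hx1 y hy
  have H₂ := hx₂ x hx2 y hy
  have key := two_terms_le (A := A) hxpos.le hlog
  by_cases hη : η ≤ 1 / 2
  · have hle : ⌊(x : ℝ) ^ (1 / 2 : ℝ)⌋₊ ≤ ⌊(x : ℝ) ^ (1 - η)⌋₊ :=
      Nat.floor_le_floor (Real.rpow_le_rpow_of_exponent_le hone (by linarith))
    calc l1Range f 1 ⌊(x : ℝ) ^ (1 - η)⌋₊ y
        = l1Range f 1 ⌊(x : ℝ) ^ (1 / 2 : ℝ)⌋₊ y
            + l1Range f (⌊(x : ℝ) ^ (1 / 2 : ℝ)⌋₊ + 1) ⌊(x : ℝ) ^ (1 - η)⌋₊ y := l1Range_split f hle y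
      _ ≤ (x : ℝ) / Real.log x ^ (A + 1) + (x : ℝ) / Real.log x ^ (A + 1) := add_le_add H₁ H₂
      _ ≤ (x : ℝ) / Real.log x ^ A := key
  · push Not at hη
    have hle : ⌊(x : ℝ) ^ (1 - η)⌋₊ ≤ ⌊(x : ℝ) ^ (1 / 2 : ℝ)⌋₊ :=
      Nat.floor_le_floor (Real.rpow_le_rpow_of_exponent_le hone (by linarith))
    have hnn : 0 ≤ (x : ℝ) / Real.log x ^ (A + 1) :=
      div_nonneg hxpos.le (Real.rpow_nonneg (by linarith) _)
    calc l1Range f 1 ⌊(x : ℝ) ^ (1 - η)⌋₊ y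
        ≤ l1Range f 1 ⌊(x : ℝ) ^ (1 / 2 : ℝ)⌋₊ y := l1Range_mono_right f hle y
      _ ≤ (x : ℝ) / Real.log x ^ (A + 1) := H₁
      _ ≤ (x : ℝ) / Real.log x ^ A := by linarith

/-! ## §D2 The class seam (all-linear systems ∧ systems with a nonlinear member) -/

/-- D2a — the crux restricted to systems of LINEAR polynomials (`k`-point Chowla for `∏ λ(aᵢt+bᵢ)` along root
classes with level `x^{1-η}`; for `k = 1` a theorem by complete multiplicativity + PNT in APs mod `a₁`). -/
def LevelLinearPiece : Prop :=
  ∀ (k : ℕ) (f : Fin k → ℤ[X]), 0 < k → IsBatemanHornSystem f → (∀ i, (f i).natDegree ≤ 1) →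
    ∀ η : ℝ, 0 < η → η < 1 → LevelAt f (1 - η)

/-- D2b — the crux restricted to systems with a member of degree `≥ 2`. -/
def LevelNonlinearPiece : Prop :=
  ∀ (k : ℕ) (f : Fin k → ℤ[X]), 0 < k → IsBatemanHornSystem f → (∃ i, 2 ≤ (f i).natDegree) →
    ∀ η : ℝ, 0 < η → η < 1 → LevelAt f (1 - η)

/-- **D2 glue (proved; TRIVIAL-SEAM):** `by_cases` on the index set of systems, no interaction. -/
theorem level_of_classSplit (hl : LevelLinearPiece) (hn : LevelNonlinearPiece) :
    LiouvilleRootClassLevel := by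
  intro k f hk hf
  by_cases h : ∀ i, (f i).natDegree ≤ 1
  · exact hl k f hk hf h
  · push Not at h
    obtain ⟨i, hi⟩ := h
    exact hn k f hk hf ⟨i, hi⟩

/-! ## §D6 The max seam -/

/-- D6 — the crux without the maximum over cut-offs (`y m ρ = x`). -/
def LevelNoMaxPiece : Prop :=
  ∀ (k : ℕ) (f : Fin k → ℤ[X]), 0 < k → IsBatemanHornSystem f →
    ∀ η : ℝ, 0 < η → η < 1 → ∀ A : ℝ, 0 < A → ∃ x₀ : ℕ, ∀ x : ℕ, x₀ ≤ x →
      l1Range f 1 ⌊(x : ℝ) ^ (1 - η)⌋₊ (fun _ _ => x) ≤ (x : ℝ) / Real.log x ^ A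

/-- `L → LevelNoMaxPiece` (instantiate `y ≡ x`).  The converse is NOT bookkeeping (a bound for the sum over
`(m, ρ)` at the common cut-off `x` says nothing termwise), so `LevelNoMaxPiece ∧ (LevelNoMaxPiece → L)` is the
only available "assembly": modus ponens, TRIVIAL-SEAM. -/
theorem noMax_of_level (h : LiouvilleRootClassLevel) : LevelNoMaxPiece := by
  intro k f hk hf η hη0 hη1 A hA
  obtain ⟨x₀, hx₀⟩ := h k f hk hf η hη0 hη1 A hA
  exact ⟨x₀, fun x hx => hx₀ x hx (fun _ _ => x) fun _ _ => le_rfl⟩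

/-! ## §S The ℓ^∞ strengthening: uniform cofactor Chowla -/

/-- **U — uniform cofactor Chowla.**  For every BH system and `A > 0` there is `C` such that for EVERY modulus
`m ≥ 1`, EVERY root class `ρ` of `m` and EVERY cut-off `y`,
`|Σ_{t ≤ y, t ≡ ρ (m), F(t)>0} λ(F(t))| ≤ C · (y/m + 1) / log(y/m + 2)^A`.
On the root class `t = ρ + ms` one has `λ(F(t)) = λ(m)·λ(F(ρ+ms)/m)`, so this is Chowla with a `(log)^{-A}` rate
for the cofactor polynomials `G_{m,ρ}(s) = F(ρ+ms)/m`, with threshold UNIFORM over the family (the height of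
`G_{m,ρ}` is `≍ m^{deg F - 1}`, unbounded relative to the length `y/m`).  Termwise (ℓ^∞) form of the crux. -/
def UniformCofactorChowla : Prop :=
  ∀ (k : ℕ) (f : Fin k → ℤ[X]), 0 < k → IsBatemanHornSystem f → ∀ A : ℝ, 0 < A → ∃ C : ℝ,
    ∀ m : ℕ, 1 ≤ m → ∀ ρ ∈ rootClasses f m, ∀ y : ℕ,
      |innerSum f m ρ y| ≤ C * ((y : ℝ) / m + 1) / Real.log ((y : ℝ) / m + 2) ^ A

/-- **T — root-count mean value (theorem-grade).**  `Σ_{m ≤ M} ρ_F(m)/m ≤ C (log M)^κ` and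
`Σ_{m ≤ M} ρ_F(m) ≤ C M (log M)^κ`: Nagell–Huxley (`ρ_F(p^e) ≤ C_F` uniformly, `disc F ≠ 0`) + Mertens.
In print; not in the tree for general systems (the tree has the prime case `polyRootCountMod`). -/
def RootCountMeanValue : Prop :=
  ∀ (k : ℕ) (f : Fin k → ℤ[X]), 0 < k → IsBatemanHornSystem f → ∃ C κ : ℝ, ∀ M : ℕ, 2 ≤ M →
    (∑ m ∈ Finset.Icc 1 M, ((rootClasses f m).card : ℝ) / m ≤ C * Real.log M ^ κ) ∧
      (∑ m ∈ Finset.Icc 1 M, ((rootClasses f m).card : ℝ)) ≤ C * M * Real.log M ^ κ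

/-- The reduction `U → T → L` as a proposition (census §S-U).  Sketch: for `y(m,ρ) ≥ x^{1-η/2}` one has
`y/m ≥ x^{η/2}`, so the `U`-bound is `≤ C (x/m+1) ((η/2) log x)^{-A'}`; otherwise it is `≤ C' (x^{1-η/2}/m + 1)`;
summing with `T` gives `O(x (log x)^{κ-A'}) + O(x^{1-η/2}(log x)^κ) ≤ x/(log x)^A` for `A' = A + κ + 1` and
`x ≥ x₀(η, A)`.  Not proved here: `U` is the crux's ℓ^∞ STRENGTHENING in the same currency (census verdict:
no leverage), so the implication carries no decision. -/
def UniformCofactorReduction : Prop :=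
  UniformCofactorChowla → RootCountMeanValue → LiouvilleRootClassLevel

/-! ## §T1 Transfer base case: the linear slice `F = X` is a theorem at every level `θ < 1`

For the one-polynomial system `fX = ![X]` the root classes of `m` reduce to `ρ = 0`, and complete multiplicativity
`λ(ms) = λ(m)λ(s)` turns the inner sum into `±Σ_{s ≤ y/m} λ(s)`; the prime number theorem for `λ` with every power
of `log` (tree theorem `Literature.NumberTheory.LFunctions.abs_sum_liouville_le_logPow`) then gives the crux's
conclusion `LevelAt fX θ` for all `0 ≤ θ < 1`.  This is the census's BC5-type special case (the typed functional
computes; the crux is inhabited-in-kind on its `G = 1`, `k = 1` slice) and the anchor of §Transfer T1. -/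

section Anchor

open Literature.NumberTheory.LFunctions

/-- The linear one-polynomial system `(X)`. -/
noncomputable abbrev fX : Fin 1 → ℤ[X] := ![X]

theorem prod_fX : (∏ i, fX i) = X := by
  simp

/-- Root classes of `F = X`: only `ρ = 0`. -/
theorem rootClasses_fX {m : ℕ} (hm : 1 ≤ m) : rootClasses fX m = {0} := by
  ext ρ
  simp only [rootClasses, prod_fX, eval_X, Finset.mem_filter, Finset.mem_range, Finset.mem_singleton]
  constructor
  · rintro ⟨hlt, hdvd⟩
    have h : m ∣ ρ := Int.natCast_dvd_natCast.mp hdvd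
    rcases Nat.eq_zero_or_pos ρ with h0 | hpos
    · exact h0
    · exact absurd (Nat.le_of_dvd hpos h) (not_le.mpr hlt)
  · rintro rfl
    exact ⟨hm, by simp⟩

/-- The filtered index set of the inner sum for `F = X`, `ρ = 0`: the multiples `m·s`, `1 ≤ s ≤ y/m`. -/
theorem filter_eq_image_fX {m : ℕ} (hm : 1 ≤ m) (y : ℕ) :
    (Finset.Icc 1 y).filter (fun t : ℕ => t ≡ 0 [MOD m] ∧ 0 < (∏ i, fX i).eval (t : ℤ)) =
      (Finset.Ioc 0 (y / m)).image (fun s => m * s) := by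
  ext t
  simp only [prod_fX, eval_X, Finset.mem_filter, Finset.mem_Icc, Finset.mem_image, Finset.mem_Ioc,
    Nat.modEq_zero_iff_dvd]
  constructor
  · rintro ⟨⟨h1, hty⟩, ⟨s, rfl⟩, -⟩
    refine ⟨s, ⟨?_, ?_⟩, rfl⟩
    · rcases Nat.eq_zero_or_pos s with h | h
      · simp [h] at h1
      · exact h
    · exact (Nat.le_div_iff_mul_le hm).mpr (by rw [mul_comm]; exact hty)
  · rintro ⟨s, ⟨hs0, hsy⟩, rfl⟩
    have hms : m * s ≤ y :=
      calc m * s ≤ m * (y / m) := Nat.mul_le_mul_left m hsy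
        _ ≤ y := Nat.mul_div_le y m
    have hpos : 0 < m * s := Nat.mul_pos hm hs0
    refine ⟨⟨hpos, hms⟩, dvd_mul_right m s, ?_⟩
    exact_mod_cast hpos

/-- The inner sum for `F = X`: `λ(m) · Σ_{s ≤ y/m} λ(s)`. -/
theorem innerSum_fX {m : ℕ} (hm : 1 ≤ m) (y : ℕ) :
    innerSum fX m 0 y = (liouville m : ℝ) * ∑ s ∈ Finset.Ioc 0 (y / m), (liouville s : ℝ) := by
  unfold innerSum
  rw [filter_eq_image_fX hm y, Finset.sum_image, Finset.mul_sum]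
  · refine Finset.sum_congr rfl fun s _ => ?_
    simp only [prod_fX, eval_X]
    rw [show ((m * s : ℕ) : ℤ).toNat = m * s from Int.toNat_natCast _, liouville_apply_mul]
    push_cast
    ring
  · intro a _ b _ h
    exact Nat.eq_of_mul_eq_mul_left hm h

/-- PNT for `λ` with every power of `log`, constant normalised to be non-negative. -/
theorem liouville_pnt (A : ℝ) : ∃ C : ℝ, 0 ≤ C ∧ ∀ z : ℝ, 2 ≤ z →
    |∑ n ∈ Finset.Ioc 0 ⌊z⌋₊, (liouville n : ℝ)| ≤ C * z / Real.log z ^ A := by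
  obtain ⟨C, hC⟩ := abs_sum_liouville_le_logPow A
  refine ⟨max C 0, le_max_right _ _, fun z hz => (hC z hz).trans ?_⟩
  apply div_le_div_of_nonneg_right _ (Real.rpow_nonneg (Real.log_nonneg (by linarith)) A)
  exact mul_le_mul_of_nonneg_right (le_max_left _ _) (by linarith)

/-- The cell bound for `F = X`: PNT when the cell is long (`y/m ≥ x^δ`), trivial otherwise. -/
theorem cell_bound_fX {C A δ : ℝ} (hC0 : 0 ≤ C) (hA : 0 ≤ A + 2)
    (hC : ∀ z : ℝ, 2 ≤ z → |∑ n ∈ Finset.Ioc 0 ⌊z⌋₊, (liouville n : ℝ)| ≤ C * z / Real.log z ^ (A + 2))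
    (hδ : 0 < δ) {x : ℕ} (hx1 : (1 : ℝ) < x) (hxδ : (2 : ℝ) ≤ (x : ℝ) ^ δ)
    {m : ℕ} (hm : 1 ≤ m) {y : ℕ} (hy : y ≤ x) :
    |innerSum fX m 0 y| ≤ C * ((x : ℝ) / m) / (δ * Real.log x) ^ (A + 2) + (x : ℝ) ^ δ := by
  rw [innerSum_fX hm]
  set q : ℕ := y / m with hq
  have hx0 : (0 : ℝ) < x := by linarith
  have hlogx : 0 < Real.log x := Real.log_pos hx1
  have hδlog : 0 < δ * Real.log x := mul_pos hδ hlogx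
  have hm0 : (0 : ℝ) < m := by exact_mod_cast hm
  have hT1 : 0 ≤ C * ((x : ℝ) / m) / (δ * Real.log x) ^ (A + 2) :=
    div_nonneg (mul_nonneg hC0 (div_nonneg hx0.le hm0.le)) (Real.rpow_nonneg hδlog.le _)
  have hT2 : 0 ≤ (x : ℝ) ^ δ := Real.rpow_nonneg hx0.le δ
  have hS : |(liouville m : ℝ) * ∑ s ∈ Finset.Ioc 0 q, (liouville s : ℝ)| ≤
      |∑ s ∈ Finset.Ioc 0 q, (liouville s : ℝ)| := by
    rw [abs_mul]
    exact mul_le_of_le_one_left (abs_nonneg _) (LiouvilleSum.abs_liouville_le_one m)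
  refine hS.trans ?_
  by_cases hcase : (x : ℝ) ^ δ ≤ q
  · have hq2 : (2 : ℝ) ≤ q := hxδ.trans hcase
    have hPNT := hC q hq2
    rw [Nat.floor_natCast] at hPNT
    refine hPNT.trans (le_add_of_le_of_nonneg ?_ hT2)
    have hqle : (q : ℝ) ≤ (x : ℝ) / m := by
      rw [le_div_iff₀ hm0]
      have h1 : q * m ≤ y := Nat.div_mul_le_self y m
      exact_mod_cast h1.trans hy
    have hq0 : (0 : ℝ) < q := by linarith
    have hlogq : δ * Real.log x ≤ Real.log q := by
      have : Real.log ((x : ℝ) ^ δ) = δ * Real.log x := Real.log_rpow hx0 δ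
      rw [← this]
      exact Real.log_le_log (by positivity) hcase
    have hlogq0 : 0 < Real.log q := hδlog.trans_le hlogq
    calc C * (q : ℝ) / Real.log q ^ (A + 2)
        ≤ C * ((x : ℝ) / m) / Real.log q ^ (A + 2) := by
          apply div_le_div_of_nonneg_right _ (Real.rpow_nonneg hlogq0.le _)
          exact mul_le_mul_of_nonneg_left hqle hC0
      _ ≤ C * ((x : ℝ) / m) / (δ * Real.log x) ^ (A + 2) := by
          apply div_le_div_of_nonneg_left (mul_nonneg hC0 (div_nonneg hx0.le hm0.le))
            (Real.rpow_pos_of_pos hδlog _)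
          exact Real.rpow_le_rpow hδlog.le hlogq hA
  · push Not at hcase
    exact le_add_of_nonneg_of_le hT1 ((LiouvilleSum.abs_sum_liouville_le q).trans hcase.le)

/-- **T1 anchor (proved).** The crux's conclusion `LevelAt` holds for the linear one-polynomial system `(X)` at every
level `0 ≤ θ < 1`: complete multiplicativity + PNT for `λ` with every power of `log`. -/
theorem levelAt_fX {θ : ℝ} (hθ0 : 0 ≤ θ) (hθ1 : θ < 1) : LevelAt fX θ := by
  intro A hA
  obtain ⟨C, hC0, hC⟩ := liouville_pnt (A + 2)
  set δ : ℝ := (1 - θ) / 2 with hδdef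
  have hδ : 0 < δ := by rw [hδdef]; linarith
  have hE : 0 < δ ^ (A + 2) := Real.rpow_pos_of_pos hδ _
  -- eventual conditions in a real variable, transferred to `ℕ`
  have hev : ∀ᶠ z : ℝ in atTop, 3 ≤ z ∧ 2 ≤ z ^ δ ∧ 8 * C ≤ δ ^ (A + 2) * Real.log z ∧
      ‖Real.log z ^ A‖ ≤ 1 / 2 * ‖z ^ δ‖ :=
    (eventually_ge_atTop 3).and (((tendsto_rpow_atTop hδ).eventually_ge_atTop 2).and
      (((Tendsto.const_mul_atTop hE Real.tendsto_log_atTop).eventually_ge_atTop (8 * C)).and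
        ((isLittleO_log_rpow_rpow_atTop A hδ).bound (by norm_num : (0 : ℝ) < 1 / 2))))
  obtain ⟨x₀, hx₀⟩ := Filter.eventually_atTop.mp (tendsto_natCast_atTop_atTop.eventually hev)
  refine ⟨x₀, fun x hx y hy => ?_⟩
  obtain ⟨hx3, hxδ, hlogC, hlittle⟩ := hx₀ x hx
  have hx0 : (0 : ℝ) < x := by linarith
  have hx1 : (1 : ℝ) < x := by linarith
  set L : ℝ := Real.log x with hLdef
  have hL : 0 < L := Real.log_pos hx1
  have hL1 : 1 ≤ L := LiouvilleSum.one_le_log hx3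
  set P : ℝ := L ^ A with hPdef
  have hP : 0 < P := Real.rpow_pos_of_pos hL A
  set M : ℕ := ⌊(x : ℝ) ^ θ⌋₊ with hMdef
  have hxθ1 : (1 : ℝ) ≤ (x : ℝ) ^ θ := Real.one_le_rpow hx1.le hθ0
  have hMle : (M : ℝ) ≤ (x : ℝ) ^ θ := Nat.floor_le (Real.rpow_nonneg hx0.le θ)
  have hM1 : 1 ≤ M := Nat.le_floor (by exact_mod_cast hxθ1)
  have hxθx : (x : ℝ) ^ θ ≤ x := by
    calc (x : ℝ) ^ θ ≤ (x : ℝ) ^ (1 : ℝ) := Real.rpow_le_rpow_of_exponent_le hx1.le hθ1.le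
      _ = x := Real.rpow_one _
  have hMx : (M : ℝ) ≤ x := hMle.trans hxθx
  -- the denominator of the cell bound
  set D : ℝ := (δ * L) ^ (A + 2) with hDdef
  have hD : D = δ ^ (A + 2) * (P * L ^ 2) := by
    rw [hDdef, Real.mul_rpow hδ.le hL.le, hPdef, Real.rpow_add hL A 2, Real.rpow_two]
  have hDpos : 0 < D := by rw [hD]; positivity
  -- Step 1: one root class per modulus, cell bound
  have hstep1 : l1Range fX 1 M y ≤ ∑ m ∈ Finset.Icc 1 M, (C * ((x : ℝ) / m) / D + (x : ℝ) ^ δ) := by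
    unfold l1Range
    refine Finset.sum_le_sum fun m hm => ?_
    have hm1 : 1 ≤ m := (Finset.mem_Icc.mp hm).1
    rw [rootClasses_fX hm1, Finset.sum_singleton]
    exact cell_bound_fX hC0 (by linarith) hC hδ hx1 hxδ hm1 (hy m 0)
  -- Step 2: evaluate the two sums
  have hIcc : Finset.Icc 1 M = Finset.Ioc 0 M := by
    simpa using Finset.Icc_add_one_left_eq_Ioc 0 M
  have hsum : ∑ m ∈ Finset.Icc 1 M, (C * ((x : ℝ) / m) / D + (x : ℝ) ^ δ)
      = C * x / D * ∑ m ∈ Finset.Ioc 0 M, (m : ℝ)⁻¹ + M * (x : ℝ) ^ δ := by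
    rw [Finset.sum_add_distrib, Finset.sum_const, Nat.card_Icc, hIcc, Finset.mul_sum]
    congr 1
    · exact Finset.sum_congr rfl fun m _ => by ring
    · simp [nsmul_eq_mul]
  have hharm : ∑ m ∈ Finset.Ioc 0 M, (m : ℝ)⁻¹ ≤ 2 * L := by
    have h1 := LiouvilleSum.sum_Ioc_inv_le_one_add_log M
    have hM0 : (0 : ℝ) < M := by exact_mod_cast hM1
    have h2 : Real.log M ≤ L := Real.log_le_log hM0 hMx
    linarith
  -- Step 3: the two halves of the target
  have hfirst : C * x / D * (2 * L) ≤ x / (2 * P) := by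
    have key : 2 * C / (δ ^ (A + 2) * L) ≤ 1 / 2 := by
      rw [div_le_iff₀ (mul_pos hE hL)]
      linarith
    calc C * x / D * (2 * L) = 2 * C / (δ ^ (A + 2) * L) * (x / P) := by
          rw [hD]
          field_simp
      _ ≤ 1 / 2 * (x / P) := mul_le_mul_of_nonneg_right key (div_nonneg hx0.le hP.le)
      _ = x / (2 * P) := by
          field_simp
  have hsecond : (M : ℝ) * (x : ℝ) ^ δ ≤ x / (2 * P) := by
    have hPx : P ≤ 1 / 2 * (x : ℝ) ^ δ := by
      have h1 : ‖Real.log (x : ℝ) ^ A‖ = P := by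
        rw [Real.norm_eq_abs, abs_of_nonneg hP.le]
      have h2 : ‖(x : ℝ) ^ δ‖ = (x : ℝ) ^ δ := by
        rw [Real.norm_eq_abs, abs_of_nonneg (Real.rpow_nonneg hx0.le δ)]
      rw [← h1, ← h2]
      exact hlittle
    have h2P : 2 * P ≤ (x : ℝ) ^ δ := by linarith
    have hxδpos : 0 < (x : ℝ) ^ δ := Real.rpow_pos_of_pos hx0 δ
    calc (M : ℝ) * (x : ℝ) ^ δ ≤ (x : ℝ) ^ θ * (x : ℝ) ^ δ :=
          mul_le_mul_of_nonneg_right hMle hxδpos.le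
      _ = (x : ℝ) ^ (1 - δ) := by
          rw [← Real.rpow_add hx0]
          congr 1
          rw [hδdef]
          ring
      _ = x / (x : ℝ) ^ δ := by
          rw [Real.rpow_sub hx0, Real.rpow_one]
      _ ≤ x / (2 * P) := div_le_div_of_nonneg_left hx0.le (by positivity) h2P
  -- conclusion
  calc l1Range fX 1 M y
      ≤ ∑ m ∈ Finset.Icc 1 M, (C * ((x : ℝ) / m) / D + (x : ℝ) ^ δ) := hstep1
    _ = C * x / D * ∑ m ∈ Finset.Ioc 0 M, (m : ℝ)⁻¹ + M * (x : ℝ) ^ δ := hsum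
    _ ≤ C * x / D * (2 * L) + x / (2 * P) := by
        gcongr
    _ ≤ x / (2 * P) + x / (2 * P) := by linarith [hfirst]
    _ = (x : ℝ) / Real.log x ^ A := by
        rw [hPdef, hLdef]
        ring

end Anchor

/-! ## §D16 The mean/fluctuation seam: polynomial Chowla with rate ∧ RELATIVE root-class level

The one decomposition of the crux "by kind" rather than "by range": the `m = 1` cell of the crux is
polynomial Chowla with a `(log x)^{-A}` rate (`PolyChowlaRate`, the parity ATOM), and what is left after
recentring every cell by its share `S_F(y)/m` of the global sum is the RELATIVE level-of-distribution
statement `RelativeRootClassLevel` (the shape in which Bombieri–Vinogradov-type theorems are stated).  Both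
pieces are CONSEQUENCES of the crux (`chowla_of_level`, `relative_of_level`) and together with the
theorem-grade root-count mean value `RootCountMeanValue` they give it back (`level_of_meanFluctuation`):
the only mathematics in the seam is the triangle inequality and the bound
`Σ_{m ≤ x^{1-η}} Σ_ρ |S_F(y(m,ρ))|/m ≤ (max_{y ≤ x} |S_F(y)|) · Σ_{m} ρ_F(m)/m` (`recentring_small`).
Census verdict: TRIVIAL-SEAM in value space (the summand cut as fluctuation + mean) and lopsided —
after `PolyChowlaRate` the residue `RelativeRootClassLevel` is the crux verbatim; recorded, not filed. -/

section MeanFluctuation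
variable {k : ℕ}

open Literature.NumberTheory.LFunctions

/-- The root classes of modulus `1`: only `ρ = 0` (the global cell). -/
theorem rootClasses_one (f : Fin k → ℤ[X]) : rootClasses f 1 = {0} := by
  ext ρ
  simp only [rootClasses, Finset.mem_filter, Finset.mem_range, Finset.mem_singleton, Nat.lt_one_iff,
    Nat.cast_one, one_dvd, and_true]

/-- Trivial bound `|innerSum f m ρ y| ≤ y`. -/
theorem abs_innerSum_le (f : Fin k → ℤ[X]) (m ρ y : ℕ) : |innerSum f m ρ y| ≤ y := by
  unfold innerSum
  refine (Finset.abs_sum_le_sum_abs _ _).trans ?_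
  refine (Finset.sum_le_sum fun t _ => LiouvilleSum.abs_liouville_le_one _).trans ?_
  rw [Finset.sum_const, nsmul_eq_mul, mul_one]
  have h := Finset.card_filter_le (Finset.Icc 1 y)
    (fun t : ℕ => t ≡ ρ [MOD m] ∧ 0 < (∏ i, f i).eval (t : ℤ))
  rw [Nat.card_Icc, Nat.add_sub_cancel] at h
  exact_mod_cast h

theorem abs_le_abs_sub_add_abs (a b : ℝ) : |a| ≤ |a - b| + |b| := by
  have h := abs_add_le (a - b) b
  rwa [sub_add_cancel] at h

end MeanFluctuation

/-- D16a — **polynomial Chowla with a log-power rate** for every Bateman–Horn product `F = ∏ fᵢ` (the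
`(m, ρ) = (1, 0)` cell of the crux at the common cut-off): for every `A > 0`, eventually
`|Σ_{t ≤ x, F(t) > 0} λ(F(t))| ≤ x/(log x)^A`.  Open for every `F` with a nonlinear irreducible factor and
for every product of `≥ 2` linear factors (Chowla with ANY rate); the qualitative `o(x)` form for irreducible
`F` is item stmt-Parity-0872 `PolyChowla`. -/
def PolyChowlaRate : Prop :=
  ∀ (k : ℕ) (f : Fin k → ℤ[X]), 0 < k → IsBatemanHornSystem f → ∀ A : ℝ, 0 < A →
    ∃ x₀ : ℕ, ∀ x : ℕ, x₀ ≤ x → |innerSum f 1 0 x| ≤ (x : ℝ) / Real.log x ^ A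

/-- D16b — **relative root-class level `x^{1-η}`**: the crux with every cell recentred by its share
`S_F(y)/m` of the global sum `S_F(y) = Σ_{t ≤ y, F(t)>0} λ(F(t))` (each class mod `m` has density `1/m`):
`Σ_{m ≤ x^{1-η}} Σ_ρ |A(m,ρ;y) − S_F(y)/m| ≤ x/(log x)^A`.  Insensitive to a global bias of `λ ∘ F`; the form
in which large-sieve / dispersion theorems (Bombieri–Vinogradov, Barban–Davenport–Halberstam) are stated. -/
def RelativeRootClassLevel : Prop :=
  ∀ (k : ℕ) (f : Fin k → ℤ[X]), 0 < k → IsBatemanHornSystem f → ∀ η : ℝ, 0 < η → η < 1 →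
    ∀ A : ℝ, 0 < A → ∃ x₀ : ℕ, ∀ x : ℕ, x₀ ≤ x → ∀ y : ℕ → ℕ → ℕ, (∀ m ρ, y m ρ ≤ x) →
      ∑ m ∈ Finset.Icc 1 ⌊(x : ℝ) ^ (1 - η)⌋₊, ∑ ρ ∈ rootClasses f m,
        |innerSum f m ρ (y m ρ) - innerSum f 1 0 (y m ρ) / m| ≤ (x : ℝ) / Real.log x ^ A

/-- `L → PolyChowlaRate`: the `(1, 0)` cell is one non-negative term of the crux's sum (at `η = 1/2`, `y ≡ x`). -/
theorem chowla_of_level (hL : LiouvilleRootClassLevel) : PolyChowlaRate := by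
  intro k f hk hf A hA
  obtain ⟨x₀, hx₀⟩ := hL k f hk hf (1 / 2) (by norm_num) (by norm_num) A hA
  refine ⟨max x₀ 1, fun x hx => ?_⟩
  have hx0 : x₀ ≤ x := le_trans (le_max_left _ _) hx
  have hx1 : (1 : ℝ) ≤ x := by exact_mod_cast le_trans (le_max_right _ _) hx
  have H : l1Range f 1 ⌊(x : ℝ) ^ (1 - 1 / 2 : ℝ)⌋₊ (fun _ _ => x) ≤ (x : ℝ) / Real.log x ^ A :=
    hx₀ x hx0 (fun _ _ => x) fun _ _ => le_rfl
  have hmem : 1 ∈ Finset.Icc 1 ⌊(x : ℝ) ^ (1 - 1 / 2 : ℝ)⌋₊ := by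
    refine Finset.mem_Icc.mpr ⟨le_rfl, Nat.le_floor ?_⟩
    rw [Nat.cast_one]
    exact Real.one_le_rpow hx1 (by norm_num)
  have h1 : ∑ ρ ∈ rootClasses f 1, |innerSum f 1 ρ x| ≤
      l1Range f 1 ⌊(x : ℝ) ^ (1 - 1 / 2 : ℝ)⌋₊ (fun _ _ => x) :=
    Finset.single_le_sum (s := Finset.Icc 1 ⌊(x : ℝ) ^ (1 - 1 / 2 : ℝ)⌋₊)
      (f := fun m => ∑ ρ ∈ rootClasses f m, |innerSum f m ρ x|)
      (fun m _ => Finset.sum_nonneg fun _ _ => abs_nonneg _) hmem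
  rw [rootClasses_one, Finset.sum_singleton] at h1
  exact h1.trans H

/-- **The seam's only content.**  Given `PolyChowlaRate` and the root-count mean value, eventually in `x`,
for ALL cut-offs `y ≤ x`: `Σ_{m ≤ x^{1-η}} Σ_ρ |S_F(y(m,ρ))/m| ≤ x/(log x)^A` — bound `|S_F(y')|` by
`x^{1/2}` for `y' ≤ x^{1/2}` and by Chowla at scale `y'` otherwise, then sum `ρ_F(m)/m`. -/
theorem recentring_small (hC : PolyChowlaRate) (hT : RootCountMeanValue) {k : ℕ} (f : Fin k → ℤ[X])
    (hk : 0 < k) (hf : IsBatemanHornSystem f) {η : ℝ} (hη0 : 0 < η) (hη1 : η < 1) (A : ℝ) (hA : 0 < A) :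
    ∃ x₀ : ℕ, ∀ x : ℕ, x₀ ≤ x → ∀ y : ℕ → ℕ → ℕ, (∀ m ρ, y m ρ ≤ x) →
      ∑ m ∈ Finset.Icc 1 ⌊(x : ℝ) ^ (1 - η)⌋₊, ∑ ρ ∈ rootClasses f m,
        |innerSum f 1 0 (y m ρ) / m| ≤ (x : ℝ) / Real.log x ^ A := by
  obtain ⟨CT, κ, hTf⟩ := hT k f hk hf
  set κ' : ℝ := max κ 0 with hκ'def
  have hκ' : 0 ≤ κ' := le_max_right _ _
  set C' : ℝ := max CT 0 with hC'def
  have hC' : 0 ≤ C' := le_max_right _ _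
  set A₁ : ℝ := A + κ' + 2 with hA₁def
  have hA₁ : 0 < A₁ := by rw [hA₁def]; linarith
  obtain ⟨x₁, hx₁⟩ := hC k f hk hf A₁ hA₁
  have hhalf : (0 : ℝ) < 1 / 2 := by norm_num
  have h1η : 0 < 1 - η := by linarith
  -- eventual conditions in a real variable, transferred to `ℕ`
  have hev : ∀ᶠ z : ℝ in atTop, 3 ≤ z ∧ (x₁ : ℝ) ≤ z ^ (1 / 2 : ℝ) ∧ 3 ≤ z ^ (1 - η) ∧
      ‖Real.log z ^ (κ' + A)‖ ≤ 1 / (2 * C' + 1) * ‖z ^ (1 / 2 : ℝ)‖ ∧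
        2 * C' * 2 ^ A₁ + 1 ≤ Real.log z := by
    refine (eventually_ge_atTop 3).and (((tendsto_rpow_atTop hhalf).eventually_ge_atTop _).and
      (((tendsto_rpow_atTop h1η).eventually_ge_atTop _).and
        (((isLittleO_log_rpow_rpow_atTop (κ' + A) hhalf).bound (by positivity)).and
          (Real.tendsto_log_atTop.eventually_ge_atTop _))))
  obtain ⟨x₀, hx₀⟩ := Filter.eventually_atTop.mp (tendsto_natCast_atTop_atTop.eventually hev)
  refine ⟨x₀, fun x hx y hy => ?_⟩
  obtain ⟨hx3, hxr, hxη, hlittle, hlog2⟩ := hx₀ x hx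
  have hx0 : (0 : ℝ) < x := by linarith
  have hx1 : (1 : ℝ) ≤ x := by linarith
  set ℓ : ℝ := Real.log x with hℓdef
  have hℓ1 : 1 ≤ ℓ := Literature.NumberTheory.LFunctions.LiouvilleSum.one_le_log hx3
  have hℓ : 0 < ℓ := by linarith
  set r : ℝ := (x : ℝ) ^ (1 / 2 : ℝ) with hrdef
  have hr : 0 < r := Real.rpow_pos_of_pos hx0 _
  have hrr : r * r = x := by
    rw [hrdef, ← Real.rpow_add hx0]; norm_num
  have hlogr : Real.log r = 1 / 2 * ℓ := by rw [hrdef, Real.log_rpow hx0]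
  -- the modulus range
  set M : ℕ := ⌊(x : ℝ) ^ (1 - η)⌋₊ with hMdef
  have hM3 : 3 ≤ M := Nat.le_floor (by exact_mod_cast hxη)
  have hM0 : (0 : ℝ) < M := by exact_mod_cast (show 0 < M by omega)
  have hMx : (M : ℝ) ≤ x := by
    calc (M : ℝ) ≤ (x : ℝ) ^ (1 - η) := Nat.floor_le (Real.rpow_nonneg hx0.le _)
      _ ≤ (x : ℝ) ^ (1 : ℝ) := Real.rpow_le_rpow_of_exponent_le hx1 (by linarith)
      _ = x := Real.rpow_one _
  have hlogM1 : 1 ≤ Real.log M := Literature.NumberTheory.LFunctions.LiouvilleSum.one_le_log (by exact_mod_cast hM3)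
  have hlogMx : Real.log M ≤ ℓ := Real.log_le_log hM0 hMx
  -- T: Σ_{m ≤ M} ρ_F(m)/m ≤ C' ℓ^{κ'}
  have hTsum : ∑ m ∈ Finset.Icc 1 M, ((rootClasses f m).card : ℝ) / m ≤ C' * ℓ ^ κ' := by
    have h := (hTf M (by omega)).1
    calc ∑ m ∈ Finset.Icc 1 M, ((rootClasses f m).card : ℝ) / m ≤ CT * Real.log M ^ κ := h
      _ ≤ C' * Real.log M ^ κ :=
          mul_le_mul_of_nonneg_right (le_max_left _ _) (Real.rpow_nonneg (by linarith) _)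
      _ ≤ C' * Real.log M ^ κ' :=
          mul_le_mul_of_nonneg_left (Real.rpow_le_rpow_of_exponent_le hlogM1 (le_max_left _ _)) hC'
      _ ≤ C' * ℓ ^ κ' :=
          mul_le_mul_of_nonneg_left (Real.rpow_le_rpow (by linarith) hlogMx hκ') hC'
  -- C at two scales: a bound for |S_F(y')| valid for every y' ≤ x
  set B : ℝ := r + (x : ℝ) / (1 / 2 * ℓ) ^ A₁ with hBdef
  have hhalfℓ : 0 < 1 / 2 * ℓ := by positivity
  have hB0 : 0 ≤ B := add_nonneg hr.le (div_nonneg hx0.le (Real.rpow_nonneg hhalfℓ.le _))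
  have hS : ∀ y' : ℕ, y' ≤ x → |innerSum f 1 0 y'| ≤ B := by
    intro y' hy'
    by_cases hcase : (y' : ℝ) ≤ r
    · exact ((abs_innerSum_le f 1 0 y').trans hcase).trans
        (le_add_of_nonneg_right (div_nonneg hx0.le (Real.rpow_nonneg hhalfℓ.le _)))
    · push Not at hcase
      have hy1 : x₁ ≤ y' := by exact_mod_cast (hxr.trans hcase.le)
      have hy0 : (0 : ℝ) < y' := hr.trans hcase
      have hlogy : 1 / 2 * ℓ ≤ Real.log y' := by
        rw [← hlogr]; exact Real.log_le_log hr hcase.le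
      have hlogy0 : 0 < Real.log y' := hhalfℓ.trans_le hlogy
      have hCy := hx₁ y' hy1
      refine le_add_of_nonneg_of_le hr.le (hCy.trans ?_)
      calc (y' : ℝ) / Real.log y' ^ A₁ ≤ (x : ℝ) / Real.log y' ^ A₁ :=
            div_le_div_of_nonneg_right (by exact_mod_cast hy') (Real.rpow_nonneg hlogy0.le _)
        _ ≤ (x : ℝ) / (1 / 2 * ℓ) ^ A₁ :=
            div_le_div_of_nonneg_left hx0.le (Real.rpow_pos_of_pos hhalfℓ _)
              (Real.rpow_le_rpow hhalfℓ.le hlogy hA₁.le)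
  -- summing the recentring terms
  have hstep : ∑ m ∈ Finset.Icc 1 M, ∑ ρ ∈ rootClasses f m, |innerSum f 1 0 (y m ρ) / m|
      ≤ B * (C' * ℓ ^ κ') := by
    calc ∑ m ∈ Finset.Icc 1 M, ∑ ρ ∈ rootClasses f m, |innerSum f 1 0 (y m ρ) / m|
        ≤ ∑ m ∈ Finset.Icc 1 M, ∑ ρ ∈ rootClasses f m, B / m := by
          refine Finset.sum_le_sum fun m hm => Finset.sum_le_sum fun ρ _ => ?_
          have hm0 : (0 : ℝ) < m := by exact_mod_cast (Finset.mem_Icc.mp hm).1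
          rw [abs_div, Nat.abs_cast]
          exact div_le_div_of_nonneg_right (hS _ (hy m ρ)) hm0.le
      _ = B * ∑ m ∈ Finset.Icc 1 M, ((rootClasses f m).card : ℝ) / m := by
          rw [Finset.mul_sum]
          refine Finset.sum_congr rfl fun m _ => ?_
          rw [Finset.sum_const, nsmul_eq_mul]
          ring
      _ ≤ B * (C' * ℓ ^ κ') := mul_le_mul_of_nonneg_left hTsum hB0
  -- the two halves of the target
  have hP : 0 < ℓ ^ A := Real.rpow_pos_of_pos hℓ A
  have hfirst : r * (C' * ℓ ^ κ') ≤ x / (2 * ℓ ^ A) := by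
    -- 2 C' ℓ^{κ'+A} ≤ r, from the little-o bound
    have hn1 : ‖ℓ ^ (κ' + A)‖ = ℓ ^ (κ' + A) := by
      rw [Real.norm_eq_abs, abs_of_nonneg (Real.rpow_nonneg hℓ.le _)]
    have hn2 : ‖r‖ = r := by
      rw [Real.norm_eq_abs, abs_of_nonneg hr.le]
    rw [hn1, hn2] at hlittle
    have h21 : 0 < 2 * C' + 1 := by positivity
    have hkey : (2 * C' + 1) * ℓ ^ (κ' + A) ≤ r := by
      have := mul_le_mul_of_nonneg_left hlittle h21.le
      rwa [← mul_assoc, mul_one_div_cancel h21.ne', one_mul] at this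
    have hkey' : 2 * C' * ℓ ^ (κ' + A) ≤ r := by
      have : 2 * C' * ℓ ^ (κ' + A) ≤ (2 * C' + 1) * ℓ ^ (κ' + A) :=
        mul_le_mul_of_nonneg_right (by linarith) (Real.rpow_nonneg hℓ.le _)
      exact this.trans hkey
    rw [Real.rpow_add hℓ] at hkey'
    rw [le_div_iff₀ (by positivity)]
    calc r * (C' * ℓ ^ κ') * (2 * ℓ ^ A) = r * (2 * C' * (ℓ ^ κ' * ℓ ^ A)) := by ring
      _ ≤ r * r := mul_le_mul_of_nonneg_left hkey' hr.le
      _ = x := hrr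
  have hsecond : (x : ℝ) / (1 / 2 * ℓ) ^ A₁ * (C' * ℓ ^ κ') ≤ x / (2 * ℓ ^ A) := by
    have hsplit : (1 / 2 * ℓ) ^ A₁ = (1 / 2) ^ A₁ * (ℓ ^ A * ℓ ^ κ' * ℓ ^ (2 : ℝ)) := by
      rw [Real.mul_rpow hhalf.le hℓ.le, hA₁def, Real.rpow_add hℓ, Real.rpow_add hℓ]
    have hhalfpow : (2 : ℝ) ^ A₁ * (1 / 2 : ℝ) ^ A₁ = 1 := by
      rw [← Real.mul_rpow (by norm_num) hhalf.le]; norm_num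
    have h2A : 0 < (2 : ℝ) ^ A₁ := Real.rpow_pos_of_pos (by norm_num) _
    have hhA : 0 < (1 / 2 : ℝ) ^ A₁ := Real.rpow_pos_of_pos hhalf _
    have hℓ2 : ℓ ^ (2 : ℝ) = ℓ * ℓ := by rw [Real.rpow_two, sq]
    have hℓκ : 0 < ℓ ^ κ' := Real.rpow_pos_of_pos hℓ _
    -- the condition 2 C' 2^{A₁} ≤ ℓ² (from 2 C' 2^{A₁} + 1 ≤ ℓ and 1 ≤ ℓ)
    have hcond : 2 * C' * 2 ^ A₁ ≤ ℓ * ℓ := by nlinarith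
    rw [hsplit, hℓ2, div_mul_eq_mul_div, div_le_div_iff₀ (by positivity) (by positivity)]
    -- goal: x * (C' ℓ^κ') * (2 ℓ^A) ≤ x * ((1/2)^A₁ * (ℓ^A ℓ^κ' (ℓ ℓ)))
    have hx' : (x : ℝ) * (C' * ℓ ^ κ') * (2 * ℓ ^ A)
        = (x * ℓ ^ κ' * ℓ ^ A) * (2 * C') := by ring
    have hy' : (x : ℝ) * ((1 / 2) ^ A₁ * (ℓ ^ A * ℓ ^ κ' * (ℓ * ℓ)))
        = (x * ℓ ^ κ' * ℓ ^ A) * ((1 / 2) ^ A₁ * (ℓ * ℓ)) := by ring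
    rw [hx', hy']
    refine mul_le_mul_of_nonneg_left ?_ (by positivity)
    -- 2 C' ≤ (1/2)^A₁ ℓ², i.e. 2 C' 2^{A₁} (1/2)^{A₁} ≤ …
    calc 2 * C' = 2 * C' * (2 ^ A₁ * (1 / 2) ^ A₁) := by rw [hhalfpow, mul_one]
      _ = 2 * C' * 2 ^ A₁ * (1 / 2) ^ A₁ := by ring
      _ ≤ ℓ * ℓ * (1 / 2) ^ A₁ := mul_le_mul_of_nonneg_right hcond hhA.le
      _ = (1 / 2) ^ A₁ * (ℓ * ℓ) := by ring
  calc ∑ m ∈ Finset.Icc 1 M, ∑ ρ ∈ rootClasses f m, |innerSum f 1 0 (y m ρ) / m|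
      ≤ B * (C' * ℓ ^ κ') := hstep
    _ = r * (C' * ℓ ^ κ') + (x : ℝ) / (1 / 2 * ℓ) ^ A₁ * (C' * ℓ ^ κ') := by rw [hBdef]; ring
    _ ≤ x / (2 * ℓ ^ A) + x / (2 * ℓ ^ A) := add_le_add hfirst hsecond
    _ = (x : ℝ) / ℓ ^ A := by ring

/-- **D16 glue (proved): mean + fluctuation.**  `PolyChowlaRate ∧ RelativeRootClassLevel ∧ RootCountMeanValue
→ L` by `|A| ≤ |A − S/m| + |S/m|`, the relative level for the first sum and `recentring_small` for the second.
The seam is the triangle inequality plus a polylogarithmic count of root classes — no estimate passes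
between the two open pieces (census: TRIVIAL-SEAM in value space). -/
theorem level_of_meanFluctuation (hC : PolyChowlaRate) (hR : RelativeRootClassLevel)
    (hT : RootCountMeanValue) : LiouvilleRootClassLevel := by
  intro k f hk hf η hη0 hη1 A hA
  obtain ⟨x₁, hx₁⟩ := hR k f hk hf η hη0 hη1 (A + 1) (by linarith)
  obtain ⟨x₂, hx₂⟩ := recentring_small hC hT f hk hf hη0 hη1 (A + 1) (by linarith)
  refine ⟨max (max x₁ x₂) ⌈Real.exp 2⌉₊, fun x hx y hy => ?_⟩
  have hx1 : x₁ ≤ x := le_trans (le_trans (le_max_left _ _) (le_max_left _ _)) hx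
  have hx2 : x₂ ≤ x := le_trans (le_trans (le_max_right _ _) (le_max_left _ _)) hx
  have hxc : ⌈Real.exp 2⌉₊ ≤ x := le_trans (le_max_right _ _) hx
  have hxe : Real.exp 2 ≤ (x : ℝ) := le_trans (Nat.le_ceil _) (by exact_mod_cast hxc)
  have hxpos : (0 : ℝ) < x := lt_of_lt_of_le (Real.exp_pos 2) hxe
  have hlog : 2 ≤ Real.log x := (Real.le_log_iff_exp_le hxpos).2 hxe
  have H₁ := hx₁ x hx1 y hy
  have H₂ := hx₂ x hx2 y hy
  have key := two_terms_le (A := A) hxpos.le hlog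
  change l1Range f 1 ⌊(x : ℝ) ^ (1 - η)⌋₊ y ≤ (x : ℝ) / Real.log x ^ A
  unfold l1Range
  calc ∑ m ∈ Finset.Icc 1 ⌊(x : ℝ) ^ (1 - η)⌋₊, ∑ ρ ∈ rootClasses f m, |innerSum f m ρ (y m ρ)|
      ≤ ∑ m ∈ Finset.Icc 1 ⌊(x : ℝ) ^ (1 - η)⌋₊, ∑ ρ ∈ rootClasses f m,
          (|innerSum f m ρ (y m ρ) - innerSum f 1 0 (y m ρ) / m| + |innerSum f 1 0 (y m ρ) / m|) :=
        Finset.sum_le_sum fun m _ => Finset.sum_le_sum fun ρ _ => abs_le_abs_sub_add_abs _ _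
    _ = (∑ m ∈ Finset.Icc 1 ⌊(x : ℝ) ^ (1 - η)⌋₊, ∑ ρ ∈ rootClasses f m,
          |innerSum f m ρ (y m ρ) - innerSum f 1 0 (y m ρ) / m|) +
        ∑ m ∈ Finset.Icc 1 ⌊(x : ℝ) ^ (1 - η)⌋₊, ∑ ρ ∈ rootClasses f m,
          |innerSum f 1 0 (y m ρ) / m| := by
        rw [← Finset.sum_add_distrib]
        exact Finset.sum_congr rfl fun m _ => Finset.sum_add_distrib
    _ ≤ (x : ℝ) / Real.log x ^ (A + 1) + (x : ℝ) / Real.log x ^ (A + 1) := add_le_add H₁ H₂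
    _ ≤ (x : ℝ) / Real.log x ^ A := key

/-- `L → RelativeRootClassLevel` (modulo the theorem-grade root count): `|A − S/m| ≤ |A| + |S/m|`, the crux for
the first sum and `recentring_small` (with `chowla_of_level`) for the second.  With `chowla_of_level` and
`level_of_meanFluctuation`: `L ↔ PolyChowlaRate ∧ RelativeRootClassLevel` given `RootCountMeanValue` — the
split is exact and both pieces are consequences of the crux. -/
theorem relative_of_level (hL : LiouvilleRootClassLevel) (hT : RootCountMeanValue) :
    RelativeRootClassLevel := by
  intro k f hk hf η hη0 hη1 A hA
  obtain ⟨x₁, hx₁⟩ := hL k f hk hf η hη0 hη1 (A + 1) (by linarith)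
  obtain ⟨x₂, hx₂⟩ := recentring_small (chowla_of_level hL) hT f hk hf hη0 hη1 (A + 1) (by linarith)
  refine ⟨max (max x₁ x₂) ⌈Real.exp 2⌉₊, fun x hx y hy => ?_⟩
  have hx1 : x₁ ≤ x := le_trans (le_trans (le_max_left _ _) (le_max_left _ _)) hx
  have hx2 : x₂ ≤ x := le_trans (le_trans (le_max_right _ _) (le_max_left _ _)) hx
  have hxc : ⌈Real.exp 2⌉₊ ≤ x := le_trans (le_max_right _ _) hx
  have hxe : Real.exp 2 ≤ (x : ℝ) := le_trans (Nat.le_ceil _) (by exact_mod_cast hxc)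
  have hxpos : (0 : ℝ) < x := lt_of_lt_of_le (Real.exp_pos 2) hxe
  have hlog : 2 ≤ Real.log x := (Real.le_log_iff_exp_le hxpos).2 hxe
  have H₁ : l1Range f 1 ⌊(x : ℝ) ^ (1 - η)⌋₊ y ≤ (x : ℝ) / Real.log x ^ (A + 1) := hx₁ x hx1 y hy
  have H₂ := hx₂ x hx2 y hy
  have key := two_terms_le (A := A) hxpos.le hlog
  unfold l1Range at H₁
  calc ∑ m ∈ Finset.Icc 1 ⌊(x : ℝ) ^ (1 - η)⌋₊, ∑ ρ ∈ rootClasses f m,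
        |innerSum f m ρ (y m ρ) - innerSum f 1 0 (y m ρ) / m|
      ≤ ∑ m ∈ Finset.Icc 1 ⌊(x : ℝ) ^ (1 - η)⌋₊, ∑ ρ ∈ rootClasses f m,
          (|innerSum f m ρ (y m ρ)| + |innerSum f 1 0 (y m ρ) / m|) :=
        Finset.sum_le_sum fun m _ => Finset.sum_le_sum fun ρ _ => abs_sub _ _
    _ = (∑ m ∈ Finset.Icc 1 ⌊(x : ℝ) ^ (1 - η)⌋₊, ∑ ρ ∈ rootClasses f m, |innerSum f m ρ (y m ρ)|) +
        ∑ m ∈ Finset.Icc 1 ⌊(x : ℝ) ^ (1 - η)⌋₊, ∑ ρ ∈ rootClasses f m,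
          |innerSum f 1 0 (y m ρ) / m| := by
        rw [← Finset.sum_add_distrib]
        exact Finset.sum_congr rfl fun m _ => Finset.sum_add_distrib
    _ ≤ (x : ℝ) / Real.log x ^ (A + 1) + (x : ℝ) / Real.log x ^ (A + 1) := add_le_add H₁ H₂
    _ ≤ (x : ℝ) / Real.log x ^ A := key

end Summit.Parity.BatemanHorn.Cruxes.LiouvilleRootClassLevel.StrategyCensus
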